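import Summits.QuantumFields.YangMills.Theorems.LuscherReductionRunningReductionInnerPhase
import Summits.QuantumFields.YangMills.Theorems.FemtoTransferGapSlabRayleigh
import HarnessLib

/-!
# The weighted-eigenfunction (double-commutator) identity for the `SU(2)` transfer matrix: `μ‖Jφ‖² − ⟨Jφ, K_β Jφ⟩ = ½∫∫ φ(U)K_β(U,V)φ(V)(J(U) − J(V))² ≤ ½M_J‖φ‖²`
# (route `FlatTubeReduction`, crux K1 `NearFlatRatioLaw` stmt-QuantumFields-24720, skeleton «ratepack-v2» stub `stub_eigenMoments` = (EM); seat `ym-line-ftr-p1` g10;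
# R2b1 RECORD rung — no summit statement is proved here)

Toward (EM) `RateTube.OneSiteEigenMoments` (second moments of the exact low one-site eigenfunctions are `O(λ_b²)`) by the MOMENT BOOTSTRAP (crux workfile `Lines/ratepack_v2.md`):
for an exact eigenfunction `K_βφ = μφ` and a bounded invariant weight `J`, the energy of `Jφ` is pinned to `μ‖Jφ‖²` up to the kernel defect row of `J` times `‖φ‖²` — the
deficit multiplies `‖Jφ‖²`, NOT `‖φ‖²` (the IMS-inequality shortcut loses exactly this and only yields first moments).  Any `L`, any `β`:
* `eigen_weighted_identity` — `μ·‖Jφ‖² − ⟨Jφ,K_βJφ⟩ = ½ ∫ φ(U)K_β(U,V)φ(V)(J(U) − J(V))² d(μ⊗μ)` (kernel symmetry, Fubini; `J` measurable, `|J| ≤ 1`, gauge- and twist-invariant);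
* ★★ `eigen_weighted_le` — if `∫ K_β(U,V)(J(U) − J(V))² dV ≤ M` for every `U`, then `μ·‖Jφ‖² ≤ ⟨Jφ,K_βJφ⟩ + ½M‖φ‖²` (`φ(U)φ(V) ≤ ½(φ(U)² + φ(V)²)` against `K·(ΔJ)² ≥ 0`).
HONEST FRAMING: kernel bookkeeping in the style of `ims_identity` / `qform_le_sum_localized_add`; femto rung R2b1 (RECORD label); not infinite volume, not a gap, not Clay.
No defs, no named facts, no `sorry`.
-/

set_option autoImplicit false

noncomputable section

open MeasureTheory Filter Topology Real
open scoped BigOperators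
open Literature.MathematicalPhysics.QuantumFieldTheory
open Literature.MathematicalPhysics.QuantumLattice

namespace Summit.QuantumFields.YangMills.Theorems.FemtoTransferGap.RateTube

open Summit.QuantumFields.YangMills.Theorems.FemtoTransferGap

variable {L : ℕ} [NeZero L]

/-! ## §1 The identity -/

set_option maxHeartbeats 400000 in
/-- **Weighted-eigenfunction identity.**  For a physical exact eigenfunction `K_βφ = μφ` and a measurable, gauge- and twist-invariant weight `|J| ≤ 1`:
`μ‖Jφ‖² − ⟨Jφ,K_βJφ⟩ = ½∫ φ(U)K_β(U,V)φ(V)(J(U) − J(V))² d(μ⊗μ)`. [cite: SimonB1983DiscreteSpectrum, §3] -/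
theorem eigen_weighted_identity (β : ℝ) {φ : GaugeConfig 3 L SU2 → ℝ} (hφ : IsPhys φ) {μ : ℝ} (heig : transferApply β φ = μ • φ)
    {J : GaugeConfig 3 L SU2 → ℝ} (hJm : Measurable J) (hJ1 : ∀ U, |J U| ≤ 1)
    (hJg : ∀ (g : Site 3 L → SU2) (U : GaugeConfig 3 L SU2), J (gaugeTransform g U) = J U)
    (hJz : ∀ (k : Fin 3), ∀ z ∈ Subgroup.center SU2, ∀ U : GaugeConfig 3 L SU2, J (twist k z U) = J U) :
    μ * l2 (fun U => J U * φ U) (fun U => J U * φ U) - qform su2Rep β (fun U => J U * φ U) (fun U => J U * φ U)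
      = (1 / 2) * ∫ p, φ p.1 * transferKernel su2Rep β p.1 p.2 * φ p.2 * (J p.1 - J p.2) ^ 2
          ∂(configMeasure SU2 L).prod (configMeasure SU2 L) := by
  haveI : SecondCountableTopology SU2 := secondCountableTopology_su2
  set Pm := (configMeasure SU2 L).prod (configMeasure SU2 L) with hPm
  have hJφ : IsPhys fun U => J U * φ U := hφ.mul_of_invariant hJm hJ1 hJg hJz
  have hJJφ : IsPhys fun U => J U * (J U * φ U) := hJφ.mul_of_invariant hJm hJ1 hJg hJz
  -- the three product integrals
  have hwm1 : Measurable fun p : GaugeConfig 3 L SU2 × GaugeConfig 3 L SU2 => J p.1 * J p.2 :=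
    (hJm.comp measurable_fst).mul (hJm.comp measurable_snd)
  have hwb1 : ∀ p : GaugeConfig 3 L SU2 × GaugeConfig 3 L SU2, |J p.1 * J p.2| ≤ 1 := fun p => by
    rw [abs_mul]; exact mul_le_one₀ (hJ1 p.1) (abs_nonneg _) (hJ1 p.2)
  have hwmU : Measurable fun p : GaugeConfig 3 L SU2 × GaugeConfig 3 L SU2 => J p.1 ^ 2 := (hJm.comp measurable_fst).pow_const 2
  have hwmV : Measurable fun p : GaugeConfig 3 L SU2 × GaugeConfig 3 L SU2 => J p.2 ^ 2 := (hJm.comp measurable_snd).pow_const 2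
  have hsq1 : ∀ U, |J U ^ 2| ≤ 1 := fun U => by
    rw [abs_pow]; exact pow_le_one₀ (abs_nonneg _) (hJ1 U)
  have hwbU : ∀ p : GaugeConfig 3 L SU2 × GaugeConfig 3 L SU2, |J p.1 ^ 2| ≤ 1 := fun p => hsq1 p.1
  have hwbV : ∀ p : GaugeConfig 3 L SU2 × GaugeConfig 3 L SU2, |J p.2 ^ 2| ≤ 1 := fun p => hsq1 p.2
  have hint1 := integrable_qformIntegrand_mul su2Rep continuous_su2Rep β hφ hφ hwm1 hwb1
  have hintU := integrable_qformIntegrand_mul su2Rep continuous_su2Rep β hφ hφ hwmU hwbU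
  have hintV := integrable_qformIntegrand_mul su2Rep continuous_su2Rep β hφ hφ hwmV hwbV
  -- `⟨Jφ, K Jφ⟩ = ∫ φKφ · J(U)J(V)`
  have hQ : qform su2Rep β (fun U => J U * φ U) (fun U => J U * φ U)
      = ∫ p, φ p.1 * transferKernel su2Rep β p.1 p.2 * φ p.2 * (J p.1 * J p.2) ∂Pm := by
    rw [qform_eq_integral_prod su2Rep continuous_su2Rep β hJφ hJφ]
    refine integral_congr_ae (ae_of_all _ fun p => ?_)
    simp only
    ring
  -- `⟨J²φ, Kφ⟩ = ∫ φKφ · J(U)²`, and by symmetry `= ∫ φKφ · J(V)²`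
  have hS : qform su2Rep β (fun U => J U * (J U * φ U)) φ = ∫ p, φ p.1 * transferKernel su2Rep β p.1 p.2 * φ p.2 * J p.1 ^ 2 ∂Pm := by
    rw [qform_eq_integral_prod su2Rep continuous_su2Rep β hJJφ hφ]
    refine integral_congr_ae (ae_of_all _ fun p => ?_)
    simp only
    ring
  have hswap : ∫ p, φ p.1 * transferKernel su2Rep β p.1 p.2 * φ p.2 * J p.2 ^ 2 ∂Pm
      = ∫ p, φ p.1 * transferKernel su2Rep β p.1 p.2 * φ p.2 * J p.1 ^ 2 ∂Pm := by
    have h := integral_prod_swap (μ := configMeasure SU2 L) (ν := configMeasure SU2 L)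
      (fun p : GaugeConfig 3 L SU2 × GaugeConfig 3 L SU2 => φ p.1 * transferKernel su2Rep β p.1 p.2 * φ p.2 * J p.1 ^ 2)
    rw [← h]
    refine integral_congr_ae (ae_of_all _ fun p => ?_)
    simp only [Prod.fst_swap, Prod.snd_swap]
    rw [transferKernel_su2Rep_symm β p.2 p.1]
    ring
  -- the eigen relation: `⟨J²φ, Kφ⟩ = μ‖Jφ‖²`
  have hE : qform su2Rep β (fun U => J U * (J U * φ U)) φ = μ * l2 (fun U => J U * φ U) (fun U => J U * φ U) := by
    rw [qform_eq_l2_transferApply, heig]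
    simp only [l2, Pi.smul_apply, smul_eq_mul]
    rw [← integral_const_mul]
    refine integral_congr_ae (ae_of_all _ fun U => ?_)
    simp only
    ring
  -- assemble: `∫…(ΔJ)² = ∫…J(U)² + ∫…J(V)² − 2∫…J(U)J(V)` and `∫…J(V)² = ∫…J(U)² = μ‖Jφ‖²`
  have hI1 : Integrable (fun p : GaugeConfig 3 L SU2 × GaugeConfig 3 L SU2 =>
      φ p.1 * transferKernel su2Rep β p.1 p.2 * φ p.2 * J p.1 ^ 2 + φ p.1 * transferKernel su2Rep β p.1 p.2 * φ p.2 * J p.2 ^ 2) Pm :=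
    hintU.add hintV
  have hI2 : Integrable (fun p : GaugeConfig 3 L SU2 × GaugeConfig 3 L SU2 =>
      2 * (φ p.1 * transferKernel su2Rep β p.1 p.2 * φ p.2 * (J p.1 * J p.2))) Pm := hint1.const_mul 2
  have hRel : ∫ p, φ p.1 * transferKernel su2Rep β p.1 p.2 * φ p.2 * (J p.1 - J p.2) ^ 2 ∂Pm
      = (∫ p, φ p.1 * transferKernel su2Rep β p.1 p.2 * φ p.2 * J p.1 ^ 2 ∂Pm
          + ∫ p, φ p.1 * transferKernel su2Rep β p.1 p.2 * φ p.2 * J p.2 ^ 2 ∂Pm)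
        - 2 * ∫ p, φ p.1 * transferKernel su2Rep β p.1 p.2 * φ p.2 * (J p.1 * J p.2) ∂Pm := by
    have e : ∀ p : GaugeConfig 3 L SU2 × GaugeConfig 3 L SU2, φ p.1 * transferKernel su2Rep β p.1 p.2 * φ p.2 * (J p.1 - J p.2) ^ 2
        = (φ p.1 * transferKernel su2Rep β p.1 p.2 * φ p.2 * J p.1 ^ 2 + φ p.1 * transferKernel su2Rep β p.1 p.2 * φ p.2 * J p.2 ^ 2)
          - 2 * (φ p.1 * transferKernel su2Rep β p.1 p.2 * φ p.2 * (J p.1 * J p.2)) := fun p => by ring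
    simp_rw [e]
    rw [integral_sub hI1 hI2, integral_add hintU hintV, integral_const_mul]
  rw [← hE, hS, hQ, hRel, hswap]
  ring

/-! ## §2 ★★ The bound -/

set_option maxHeartbeats 400000 in
/-- ★★ **Weighted-eigenfunction bound.**  For a physical exact eigenfunction `K_βφ = μφ`, a measurable, gauge- and twist-invariant weight `|J| ≤ 1` whose kernel defect row is
bounded, `∫ K_β(U,V)(J(U) − J(V))² dV ≤ M` for every `U`: `μ‖Jφ‖² ≤ ⟨Jφ, K_β Jφ⟩ + ½M‖φ‖²`. [cite: SimonB1983DiscreteSpectrum, §3] -/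
theorem eigen_weighted_le (β : ℝ) {φ : GaugeConfig 3 L SU2 → ℝ} (hφ : IsPhys φ) {μ : ℝ} (heig : transferApply β φ = μ • φ)
    {J : GaugeConfig 3 L SU2 → ℝ} (hJm : Measurable J) (hJ1 : ∀ U, |J U| ≤ 1)
    (hJg : ∀ (g : Site 3 L → SU2) (U : GaugeConfig 3 L SU2), J (gaugeTransform g U) = J U)
    (hJz : ∀ (k : Fin 3), ∀ z ∈ Subgroup.center SU2, ∀ U : GaugeConfig 3 L SU2, J (twist k z U) = J U)
    {M : ℝ} (hM : ∀ U : GaugeConfig 3 L SU2, ∫ V, transferKernel su2Rep β U V * (J U - J V) ^ 2 ∂configMeasure SU2 L ≤ M) :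
    μ * l2 (fun U => J U * φ U) (fun U => J U * φ U) ≤ qform su2Rep β (fun U => J U * φ U) (fun U => J U * φ U) + (1 / 2) * M * l2 φ φ := by
  haveI : SecondCountableTopology SU2 := secondCountableTopology_su2
  set ν := configMeasure SU2 L with hν
  set Pm := ν.prod ν with hPm
  set K : GaugeConfig 3 L SU2 × GaugeConfig 3 L SU2 → ℝ := fun p => transferKernel su2Rep β p.1 p.2 with hK
  set D : GaugeConfig 3 L SU2 × GaugeConfig 3 L SU2 → ℝ := fun p => (J p.1 - J p.2) ^ 2 with hD
  have hid := eigen_weighted_identity β hφ heig hJm hJ1 hJg hJz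
  obtain ⟨C, hC⟩ := hφ.bounded
  obtain ⟨Mk, hMk⟩ := exists_transferKernel_le su2Rep continuous_su2Rep β (L := L)
  have hD0 : ∀ p, 0 ≤ D p := fun p => sq_nonneg _
  have hDm : Measurable D := ((hJm.comp measurable_fst).sub (hJm.comp measurable_snd)).pow_const 2
  have hDb : ∀ p : GaugeConfig 3 L SU2 × GaugeConfig 3 L SU2, |D p| ≤ 4 := by
    intro p
    rw [abs_of_nonneg (hD0 p)]
    have h1 := hJ1 p.1
    have h2 := hJ1 p.2
    rw [abs_le] at h1 h2
    show (J p.1 - J p.2) ^ 2 ≤ 4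
    nlinarith
  have hKD_symm : ∀ p : GaugeConfig 3 L SU2 × GaugeConfig 3 L SU2, K p.swap * D p.swap = K p * D p := by
    intro p
    simp only [hK, hD, Prod.fst_swap, Prod.snd_swap]
    rw [transferKernel_su2Rep_symm β p.2 p.1]
    ring
  have hKm : AEStronglyMeasurable K Pm := (continuous_transferKernel su2Rep continuous_su2Rep β).aestronglyMeasurable
  have hsqU : Integrable (fun p : GaugeConfig 3 L SU2 × GaugeConfig 3 L SU2 => φ p.1 ^ 2 * (K p * D p)) Pm := by
    have hm : AEStronglyMeasurable (fun p : GaugeConfig 3 L SU2 × GaugeConfig 3 L SU2 => φ p.1 ^ 2 * (K p * D p)) Pm :=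
      ((hφ.measurable.comp measurable_fst).pow_const 2).aestronglyMeasurable.mul (hKm.mul hDm.aestronglyMeasurable)
    refine integrable_prod_of_bounded hm (C := C ^ 2 * (Mk * 4)) fun p => ?_
    have hK0 : 0 < K p := transferKernel_pos su2Rep β p.1 p.2
    rw [abs_mul, abs_mul, abs_of_pos hK0, abs_pow]
    refine mul_le_mul (pow_le_pow_left₀ (abs_nonneg _) (hC p.1) 2) ?_ (by positivity) (by positivity)
    exact mul_le_mul (hMk p.1 p.2) (hDb p) (abs_nonneg _) (hK0.le.trans (hMk p.1 p.2))
  have hsqV : Integrable (fun p : GaugeConfig 3 L SU2 × GaugeConfig 3 L SU2 => φ p.2 ^ 2 * (K p * D p)) Pm := by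
    have hm : AEStronglyMeasurable (fun p : GaugeConfig 3 L SU2 × GaugeConfig 3 L SU2 => φ p.2 ^ 2 * (K p * D p)) Pm :=
      ((hφ.measurable.comp measurable_snd).pow_const 2).aestronglyMeasurable.mul (hKm.mul hDm.aestronglyMeasurable)
    refine integrable_prod_of_bounded hm (C := C ^ 2 * (Mk * 4)) fun p => ?_
    have hK0 : 0 < K p := transferKernel_pos su2Rep β p.1 p.2
    rw [abs_mul, abs_mul, abs_of_pos hK0, abs_pow]
    refine mul_le_mul (pow_le_pow_left₀ (abs_nonneg _) (hC p.2) 2) ?_ (by positivity) (by positivity)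
    exact mul_le_mul (hMk p.1 p.2) (hDb p) (abs_nonneg _) (hK0.le.trans (hMk p.1 p.2))
  have hswap : ∫ p, φ p.2 ^ 2 * (K p * D p) ∂Pm = ∫ p, φ p.1 ^ 2 * (K p * D p) ∂Pm := by
    have h := integral_prod_swap (μ := ν) (ν := ν) (fun p : GaugeConfig 3 L SU2 × GaugeConfig 3 L SU2 => φ p.1 ^ 2 * (K p * D p))
    rw [← h]
    refine integral_congr_ae (ae_of_all _ fun p => ?_)
    simp only [Prod.fst_swap]
    rw [hKD_symm p]
  -- the remainder is at most `∫ φ(U)² K D`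
  have hR : ∫ p, φ p.1 * transferKernel su2Rep β p.1 p.2 * φ p.2 * (J p.1 - J p.2) ^ 2 ∂Pm ≤ ∫ p, φ p.1 ^ 2 * (K p * D p) ∂Pm := by
    have hle : ∫ p, φ p.1 * transferKernel su2Rep β p.1 p.2 * φ p.2 * (J p.1 - J p.2) ^ 2 ∂Pm
        ≤ ∫ p, ((1 / 2) * (φ p.1 ^ 2 * (K p * D p)) + (1 / 2) * (φ p.2 ^ 2 * (K p * D p))) ∂Pm := by
      refine integral_mono (integrable_qformIntegrand_mul su2Rep continuous_su2Rep β hφ hφ hDm hDb)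
        ((hsqU.const_mul _).add (hsqV.const_mul _)) fun p => ?_
      have hw : 0 ≤ K p * D p := mul_nonneg (transferKernel_pos su2Rep β p.1 p.2).le (hD0 p)
      have h2 : φ p.1 * φ p.2 ≤ (1 / 2) * (φ p.1 ^ 2 + φ p.2 ^ 2) := by nlinarith [sq_nonneg (φ p.1 - φ p.2)]
      calc φ p.1 * transferKernel su2Rep β p.1 p.2 * φ p.2 * (J p.1 - J p.2) ^ 2
          = (φ p.1 * φ p.2) * (K p * D p) := by simp only [hK, hD]; ring
        _ ≤ (1 / 2) * (φ p.1 ^ 2 + φ p.2 ^ 2) * (K p * D p) := mul_le_mul_of_nonneg_right h2 hw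
        _ = (1 / 2) * (φ p.1 ^ 2 * (K p * D p)) + (1 / 2) * (φ p.2 ^ 2 * (K p * D p)) := by ring
    rw [integral_add (hsqU.const_mul _) (hsqV.const_mul _), integral_const_mul, integral_const_mul, hswap] at hle
    linarith
  -- `∫ φ(U)² K D d(ν⊗ν) = ∫ φ(U)² (∫ K D dV) dU ≤ M‖φ‖²`
  have hrow : ∫ p, φ p.1 ^ 2 * (K p * D p) ∂Pm ≤ M * l2 φ φ := by
    rw [integral_prod _ hsqU]
    have hl2 : l2 φ φ = ∫ U, φ U ^ 2 ∂ν := by simp only [l2, pow_two, hν]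
    rw [hl2, ← integral_const_mul]
    refine integral_mono_of_nonneg (ae_of_all _ fun U => ?_) ((hφ.integrable_sq).const_mul M) (ae_of_all _ fun U => ?_)
    · exact integral_nonneg fun V => mul_nonneg (sq_nonneg _) (mul_nonneg (transferKernel_pos su2Rep β _ _).le (hD0 (U, V)))
    · show ∫ V, φ (U, V).1 ^ 2 * (K (U, V) * D (U, V)) ∂ν ≤ M * φ U ^ 2
      simp only
      rw [integral_const_mul, mul_comm]
      exact mul_le_mul_of_nonneg_right (hM U) (sq_nonneg _)
  have h12 : (0 : ℝ) ≤ 1 / 2 := by norm_num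
  have := mul_le_mul_of_nonneg_left (hR.trans hrow) h12
  linarith [hid]

end Summit.QuantumFields.YangMills.Theorems.FemtoTransferGap.RateTube

end
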